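import Mathlib
import HarnessLib
import HarnessLib.Audit
import Summits.AtomisticToContinuum.Statement
import Literature.MathematicalPhysics.KineticTheory.HardSphereEulerProofs

/-!
Route: VanishingNoise

# Route VanishingNoise — dice inside the collision: OVY at a vanishing FRACTION of randomised
collisions, plus law-level continuity at zero dice

X = DiceContinuity ∧ RareDiceEuler ("it suffices to show") — the contact-dice re-parametrisation
(card angular-noise-ladder, option (U), grafted here on the refuters' triage of 2026-08-15) of the
original vanishing-noise thesis X_VN (OVY conservative noise of intensity γ_N → 0; its informal
cruxes UniformInNoiseEntropy / NoisyDeterministicComparison / NoisyOVYHardSpheres are superseded and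
stay on the ledger only as inert support entries; the borrowed entropy form RelEntropyVanishing
stays attached as an optional stronger waypoint, kind support, together with the entropy routes'
shared glue Assembly = RelEntropyVanishing → HydrodynamicLimit (item 0769, assembly-kind) — none of
these is on the deciding path; they cannot be dropped by planner verbs: assembly-kind entries are
undroppable and any item-set edit is refused `route.multi-assembly` while Assembly and Assembly2
coexist, so removing them is an operator clean-up).
THE DICE GAS dflow(q): the conjunct's own N+1 hard spheres of diameter ε_N = σ(N+1)^(-1/3) on 𝕋³
(fixed reduced density; local Gibbs data P_N = localGibbsLaw σ a₀ u₀ θ₀), deterministic free flight,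
and at each collision an independent coin ~ Ber(q): tails ⇒ the conjunct's specular (elastic) rule;
heads ⇒ the outgoing relative velocity keeps its modulus |g| and its direction is redrawn with the
flux-weighted cosine (Lambertian / Knudsen) law on the hemisphere of the line of centres, in the
pair centre-of-mass frame (realised as (ω̂+ξ̂)/‖ω̂+ξ̂‖ with ξ standard Gaussian). Every collision
conserves particle number, momentum and the true kinetic energy |v|²/2; Liouville ⊗ Maxwellian and
every local Gibbs law are invariant for every q (the cosine kernel is self-dual), so the equation of
state p = ρθZ(ρσ³) and the target hs-Euler system are the conjunct's for every q, and q = 0 IS the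
conjunct's gas (support DiceAtZero). The model is an inline `let` block over existing declarations
(freeFlight, contactSet, IsIncoming, collidePair, hardSphereDomain, Measure.infinitePi, stdGaussian,
bernoulliMeasure) shared verbatim by all items; no definition request is outstanding.
(1) RareDiceEuler (crux, rank 3) — OVY AT A VANISHING FRACTION OF RANDOMISED COLLISIONS: for every
dice schedule q_N → 0 with q_N(N+1)^(1/3) → ∞, the dice gas started from local Gibbs data whose
fields converge at t = 0 has the Euler limit before the first shock (convergence in probability of
the χ-tested density / momentum / energy fields at every t < T: the conclusion of
HydrodynamicLimitFor verbatim with dflow_t in place of Φ_t). This is OllaVaradhanYau1993 Thm 2.1 /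
Cor. 2.2 (p. 531) in OVY's OWN regime: their intensity θ(ε) → ∞ with εθ(ε) → 0 (p. 527) reads, in
collision units at fixed reduced density (≍ (N+1)^(1/3) = ε^(-1) collisions per particle per unit
time), "a fraction q_N ≍ εθ → 0 of the collisions is randomised and q_N(N+1)^(1/3) ≍ θ → ∞" —
transplanted from bulk velocity-exchange noise on a smooth Hamiltonian system with modified kinetic
energy to contact dice on hard spheres with |v|²/2.
(2) DiceContinuity (crux, rank 2) — LAW-LEVEL CONTINUITY AT ZERO DICE, UNIFORMLY IN N: with σ₀
depending on the profiles only, for every t < T, continuous χ and 1-Lipschitz F bounded by 1 of the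
three tested fields, E_{P_N} F(fields(Φ_t)) − E_{P_N ⊗ noise(q_N)} F(fields(dflow_t)) → 0 along
EVERY schedule q_N → 0. Its foreseen engine is CoinInfluence (crux, rank 4): the summed law-level
influence Σ_k |E[F ∣ coin_k := heads] − E[F ∣ coin_k := tails]| of re-randomising single collisions
is O(1) uniformly in N, q ≤ q₀ and the horizon K (≍ N^(4/3)t collisions of influence O(N^(-4/3))
each — a BOUND, no cancellation), which is dE_q F/dq by Russo's formula and integrates to |Δ_N(q)| ≤
C·q.
(1) is the noisy rung with nothing left to make uniform; (2) carries the entire deterministic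
difficulty as a finite-time stability statement about LAWS of macroscopic fields — no ergodic
theorem and no classification of stationary states is ever asked of the specular gas. The dice
transfer taking (1)+(2) to the sub-problem Statement is PROVED inside the deciding theorem, which is
crux-only since rev 10: `closes : DiceContinuity → RareDiceEuler → HydrodynamicLimit` (glue.lean, ≈
210 lines, standard axioms) — portmanteau along the schedule q_N := (N+1)^(-1/6) with the
1-Lipschitz cut-offs F_δ = min(1, (dev − δ/2)₊) of the three deviations, the lower bound
min(1,δ/2)·P_N(A_δ) ≤ E_{P_N} F_δ on the deterministic side (measurable fields, P_N a probability
law by isProbabilityMeasure_localGibbsLaw for σ ≤ 1/2, whence σ₀ := min(σ₁, σ₂, 1/2)), the upper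
bound E F_δ ≤ (P_N ⊗ noise)(A_(δ/2)) on the dice side with no measurability asked of dflow, and a
squeeze. The former glue item Assembly2 = DiceContinuity → RareDiceEuler → HydrodynamicLimit
(assembly-kind, not droppable) is now the one-line corollary `fun h₁ h₂ => closes h₁ h₂`.
Lean: `DiceContinuity ∧ RareDiceEuler`

Rationale: WHY THIS LINE. PROBLEMS.md §3 lists "relative-entropy method à la Yau/OVY with vanishing noise →
zero-noise limit". OllaVaradhanYau1993 use their noise for exactly one purpose — the ergodic
(one-block) step, which FritzFunakiLebowitz1994 / LiveraniOlla1996 isolate (conservative noise makes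
finite-entropy stationary states Gibbsian) — and their printed regime θ(ε) → ∞, εθ(ε) → 0 (p. 527)
already IS a vanishing fraction of randomised collisions once the noise is counted in the collision
units of a hard-sphere gas at fixed reduced density. Putting the dice INSIDE the collision (card
angular-noise-ladder; refuter triage 2026-08-15: "graft HS(p) here as the base case, not a new
route") makes this literal: the interpolation parameter is the fraction q of real collisions whose
scattering angle is redrawn, the noisy rung RareDiceEuler sits exactly in OVY's regime with nothing
to make uniform, Gibbs states / EOS / target PDE do not move with q, and q = 0 is the conjunct — so
the original crux "uniform-in-γ entropy bound" disappears. The zero-noise step is then neither an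
ergodic nor an SRB-selection problem but a finite-time, law-level stability statement
(DiceContinuity), and the imported tool is the sharp-threshold calculus of product measures: by
Russo's formula (Russo1981; Grimmett2018 Thm 4.66 and Ex. 4.9, page-checked) dE_q F/dq is the summed
pivotality of the coins, so an O(1) budget for the summed LAW-level influences of single
re-randomised collisions (CoinInfluence: ≍ N^(4/3)t collisions, O(N^(-4/3)) each — the size exact
pair conservation gives at the collision itself, |Δ field_χ| ≤ ‖∇χ‖∞ ε_N |g|/(N+1)) yields |Δ_N(q)|
≤ C·q with NO cancellation, whereas a swap at fixed endpoints (retired sibling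
SpecularLambertianSwap, q = 1 versus 0) needs o(N^(-4/3)) per collision. Imported areas, with the
dictionary [coin heads at a collision] ↦ [diffusely reflecting contact, cosine law], [q_N → 0,
q_N(N+1)^(1/3) → ∞] ↦ [OVY's εθ → 0, θ → ∞]: relative entropy method (Yau1991, OllaVaradhanYau1993,
KipnisLandim1999 Ch. 6); macro-ergodicity from conservative noise (FritzFunakiLebowitz1994,
LiveraniOlla1996) and Knudsen random reflections (doi:10.1007/s00205-008-0120-x); influences / noise
sensitivity / Lindeberg swapping (Russo1981, BenjaminiKalaiSchramm1999, Grimmett2018 §4.5–4.7,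
Chatterjee2006); statistical stability of hyperbolic systems under rare random kicks
(KellerLiverani2009, arXiv:1210.1261).

RANKED CRUXES. #2 DiceContinuity — law-level continuity at q = 0, uniformly in N, for bounded
Lipschitz functionals of the three tested fields, along every schedule q_N → 0 (why it might fail:
θ_N = q_N(N+1)^(1/3) → ∞ kicks per particle still randomise every trajectory; if the pre-shock Euler
background turns a local conservative surgery of the non-equilibrium law into an O(1) shift of field
LAWS uniformly in N, it fails; sources OllaVaradhanYau1993, arXiv:1210.1261, KellerLiverani2009,
Spohn1991). #3 RareDiceEuler — OllaVaradhanYau1993 Thm 2.1 / Cor. 2.2 for the dice gas in OVY's own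
regime q_N → 0, q_N(N+1)^(1/3) → ∞ (why it might fail: OVY's step (B) used bulk exchange noise at θ
→ ∞ on all near pairs; contact-only angular dice with deterministic partner selection are a
degenerate noise, LiveraniOlla1996 Thm 1.2 excludes |v|²/2, and the cubic energy current needs the
unproved high-momentum input; sources OllaVaradhanYau1993, LiveraniOlla1996,
FritzFunakiLebowitz1994, doi:10.1007/s00205-008-0120-x, Rezakhanlou2003). #4 CoinInfluence — the
O(1) Russo budget for the summed law-level influences of single coins, uniformly in N ≥ N₀, q ≤ q₀
and the horizon K (why it might fail: pathwise one flipped coin decorrelates a sound cone of ≍ N·s³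
particles within O(log N) collision times; the O(N^(-4/3)) law-level bound needs the future field
law to forget a local measure-preserving surgery of the time-t_k law — false if f_t carries
macroscopically relevant fine structure; sources Grimmett2018, Russo1981, BenjaminiKalaiSchramm1999,
arXiv:1210.1261, Chatterjee2006).

KILL CRITERIA. (a) ¬CoinInfluence with a witness whose summed influence grows like a power of N at
fixed small q removes the only engine of DiceContinuity (pivot: influence budget for smoother
functionals / after mesoscopic time-averaging, filed as a repaired item, never a rewording);
¬DiceContinuity itself — an O(1) gap between the field laws of the dice gas and of the specular gas
along some schedule q_N → 0 for some pre-shock datum — closes the route `refuted:DiceContinuity` (it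
refutes this interpolation, not the conjunct). (b) If RareDiceEuler provably needs q_N bounded below
(the one-block step fails for contact dice at every θ_N → ∞, i.e. a fixed fraction of collisions
must be randomised), the noisy rung has left OVY's regime and the line is dead: close
`refuted:RareDiceEuler`. (c) A refutation that only hits the cubic energy current (velocity tails)
forces a restatement of RareDiceEuler / DiceContinuity for density and momentum plus bounded energy
functionals, not a close — the conjunct itself tests the energy field, so that pivot would be
recorded as a conditional bridge on the shared tail input.

NOT DECOMPOSED YET. The interior of RareDiceEuler (large deviations for local Gibbs hard-sphere
laws, the entropy Gronwall with collisional contact currents, one-block / two-block for contact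
dice, the velocity-tail input) — cut only after a prover's census or when the shared inputs on the
board move; the observable class in which DiceContinuity is best proved beyond bounded-Lipschitz F;
block sizes and the mesoscopic time-averaging that CoinInfluence may need. Deliberately only ONE
child of DiceContinuity (CoinInfluence) is filed now, because it is typable and MD-testable today.

CHEAPEST FALSIFIER. Event-driven MD of the dice gas with common random numbers: N = 10⁴–10⁵ spheres
at φ = 0.05–0.2, a smooth shear or sound-wave local Gibbs datum, q ∈ {0, N^(-1/2), N^(-1/3),
N^(-1/6)}, t = a few sound times. Measure (i) the gap E F(fields) at q versus q = 0 — DiceContinuity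
predicts O(q) uniformly in N; (ii) the single-coin law-level influence by paired runs differing in
one coin — CoinInfluence predicts O(N^(-4/3)) after averaging although the two trajectories
decorrelate completely within O(log N) collisions. An influence decaying slower than
N^(-4/3)·polylog N, or a gap that does not shrink with q, retires the line before any further Lean
is written.

TWO-LAYER PLAN. DiceContinuity ⇐ CoinInfluence → DiceAtZero → DiceWellPosed → DiceContinuity (k = 3;
glue = Russo's formula for the Bernoulli(q) product of the a.s. finitely many coins used before time
t, |E_q F − E_0 F| ≤ q · sup_{q' ≤ q} Σ_k |E_{q'} Δ_k F| ≤ C·q, and E_0 = the specular expectation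
by DiceAtZero; measurability from DiceWellPosed). RareDiceEuler ⇐ (one-block for contact dice at θ_N
→ ∞) → (entropy Gronwall + LD + tails ⇒ fields) → RareDiceEuler, to be cut only after a census.

SUPPORT. DiceAtZero (q = 0 is the conjunct's gas P_N ⊗ noise-a.s.: bernoulliMeasure at 0 is δ_false,
every step specular, dflow = the Alexander flow; provable now); DiceWellPosed (measurability of
dflow_t and a.s. good collision sequences — simple incoming collisions, no contact inside a flight,
exit times summing to ∞ — by Alexander's flux argument, both kernels mapping the incoming contact
flux onto the outgoing one; GST2013, CIP1994, doi:10.1007/s00205-008-0120-x); Assembly2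
(assembly-kind: the dice transfer DiceContinuity → RareDiceEuler → HydrodynamicLimit as a standalone
Prop; since rev 10 the deciding theorem `closes : DiceContinuity → RareDiceEuler →
HydrodynamicLimit` proves this transfer inline, so Assembly2 is the corollary `fun h₁ h₂ => closes
h₁ h₂` and no longer a hypothesis of `closes`); RelEntropyVanishing (support, shared: the optional
entropy-form upgrade of the conclusion, reached if DiceContinuity is ever proved as klDiv(P⁰_t ∣
P^q_t) = o(N)) with the entropy routes' shared glue Assembly (0769, RelEntropyVanishing →
HydrodynamicLimit, entropy inequality; candidate proof on file). Assembly-kind entries are not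
droppable by planner verbs and every item-set edit is refused (`route.multi-assembly`) while
Assembly and Assembly2 coexist, so both stay attached off the deciding path, and so do the three
superseded informal γ-noise entries UniformInNoiseEntropy / NoisyDeterministicComparison /
NoisyOVYHardSpheres (inert; operator clean-up: drop 0811/0812/0813 and detach 0769/0766 from this
route once an assembly entry can be removed — e.g. after Assembly2 is closed by its one-line proof).

SOURCES. OllaVaradhanYau1993 = doi:10.1007/bf02096727 (Thm 2.1 and Cor. 2.2 p. 531; regime p. 527;
§3–5), Yau1991, KipnisLandim1999 Ch. 6, Spohn1991 Part I Ch. 3; FritzFunakiLebowitz1994,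
LiveraniOlla1996, doi:10.1007/s00205-008-0120-x, Rezakhanlou2003; Russo1981, Grimmett2018 (Thm 4.66,
Ex. 4.9), BenjaminiKalaiSchramm1999, Chatterjee2006; KellerLiverani2009, arXiv:1210.1261; GST2013,
CIP1994 (hard-sphere flow à la Alexander).

Novelty: Delta: the interpolation parameter is the FRACTION q of randomised collisions — this puts OVY's own
printed regime (q_N → 0, q_N·N^(1/3) → ∞) on the noisy side with nothing to make uniform, and turns
the zero-noise step into a Russo influence budget at the critical per-collision scale N^(-4/3) that
needs a bound but no cancellation; combination not found in the searched literature or on the board.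
Claimed grade: new-combination.
Nearest prior art found: OllaVaradhanYau1993 (doi:10.1007/bf02096727 Thm 2.1, regime p. 527: bulk
exchange noise, bounded velocities); LiveraniOlla1996, FritzFunakiLebowitz1994 (macro-ergodicity
from conservative noise); card angular-noise-ladder (U) + route SpecularLambertianSwap (contact dice
at FIXED endpoints q = 1 vs 0, swap needs o(N^(-4/3)) per collision); arXiv:1210.1261 Demers–Zhang,
KellerLiverani2009 (statistical stability of billiards under random kicks, one particle, SRB);
Russo1981, Grimmett2018 Thm 4.66, BenjaminiKalaiSchramm1999 (influences).
Searches (2026-08-15): `lit galaxy search --star all` ×3 ("Hamiltonian system with weak noise" 17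
rows, none zero-noise Euler; "weak noise hydrodynamic limit" 0; "random perturbation of the
collision" 0); `lit search --source arxiv` ×6 (zero/vanishing-noise hydrodynamic limits: SPDE LDP
only; random scattering angle hard spheres: 0; arXiv:1210.1261); `lit search --hybrid` ×4
(Grimmett2018 §4.5–4.7, Dorfman1999, Gaspard1998); `lit frontier` (arXiv:2310.13338
CanestrariLiveraniOlla2026); `lit bridge  [refs: 10.1007/bf02096727, 1210.1261, 2310.13338, doi:10.1007/bf02096727, OllaVaradhanYau1993, LiveraniOlla1996, FritzFunakiLebowitz1994, KellerLiverani2009, Russo1981, Grimmett2018, BenjaminiKalaiSchramm1999, Dorfman1999, Gaspard1998, CanestrariLiveraniOlla2026]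

Barriers (technique_class: relative-entropy, stochastic-interpolation, influence-budget): - technique_class: relative-entropy, stochastic-interpolation, influence-budget
- Literature.Barriers.AtomisticToContinuum.BoltzmannHypothesisBarrier: met on the noisy side only
and handled by the barrier's own evasion (i) (conservative noise supplies step (B)) at the weakest
printed strength θ_N → ∞; the deterministic gas is never asked to classify stationary states —
DiceContinuity / CoinInfluence are finite-time, law-level stability statements; conceded that
RareDiceEuler's step (B) for CONTACT dice with |v|²/2 is beyond LiveraniOlla1996.
- Literature.Barriers.AtomisticToContinuum.BoltzmannHypothesisBarrierNarrow: same — the one-block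
input is bought with dice on the noisy side, never assumed for the deterministic flow.
- Literature.Barriers.AtomisticToContinuum.MacroErgodicityBarrier: its evasion (a) (bulk
conservative noise ⇒ macro-ergodicity, FritzFunakiLebowitz1994 Thms 2.3–2.5) is the template for
RareDiceEuler's layer 2; no sector condition at Euler scale; it does not bear on DiceContinuity.
- Literature.Barriers.AtomisticToContinuum.HighMomentumCutoffBarrier: APPLIES to RareDiceEuler (true
kinetic energy, cubic energy current); it does not evade it; the bet is the board's shared
velocity-tail input (re-posed 0781 / EnergyCurrentTails), for which the dice gas with θ_N → ∞
angle-averaging kicks is the easiest member of the family; DiceContinuity and CoinInfluence use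
bounded Lipschitz observables only and are untouched.
- Literature.Barriers.AtomisticToContinuum.Shock

sub-problem: HydrodynamicLimit · status: blocked · opened planner-plan-AtomisticToContinuum-HydrodynamicLimit-0 2026-08-13T19:13:07Z · rev 10 · ledger route-AtomisticToContinuum-VanishingNoise
GENERATED by the gate from the ledger (D-0016/17). Provers cite these decls: `theorem foo : Summit.AtomisticToContinuum.HydrodynamicLimit.Theses.VanishingNoise.<Decl> := …` in Summits/AtomisticToContinuum/HydrodynamicLimit/Theorems/<Name>.lean.
-/

namespace Summit.AtomisticToContinuum.HydrodynamicLimit.Theses.VanishingNoise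

open scoped BigOperators Topology Manifold Classical MeasureTheory ProbabilityTheory Matrix InnerProductSpace ComplexConjugate ContinuousMap
open Filter Set Function TopologicalSpace MeasureTheory

attribute [summit_statement] _root_.HydrodynamicLimit

/-- item stmt-AtomisticToContinuum-8723 · crux · rank 2 · open · by planner
why it might fail: θ_N = q_N·N^(1/3) → ∞ kicks per particle still randomise every trajectory; if the pre-shock Euler background turns a local conservative surgery of the non-equilibrium law into an O(1) shift of field LAWS uniformly in N (incipient shear/acoustic instability), it fails.
sources: OllaVaradhanYau1993, arXiv:1210.1261, KellerLiverani2009, Spohn1991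
[crux] LAW-LEVEL CONTINUITY AT ZERO DICE FRACTION, UNIFORMLY IN N (card angular-noise-ladder (U);
the observable-level form refuters g28-1/6/0 asked for on 0812). For continuous profiles there is σ₀
> 0 such that for 0 < σ < σ₀, every classical hs-Euler solution on [0,T), every family of
hard-sphere flows Φ_N with local Gibbs data whose fields converge at t = 0, every t < T, continuous
χ, 1-Lipschitz F bounded by 1 of the three χ-tested empirical fields and EVERY dice schedule q_N →
0: E_(P_N) F(fields(Φ_N,t z)) − E_(P_N ⊗ noise(q_N)) F(fields(dflow_t(z, ξ))) → 0 — equivalently ∀η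
∃q₀, N₀ ∀N ≥ N₀ ∀q ≤ q₀: |Δ_N(q)| ≤ η. The dice gas dflow is the inline `let` block shared verbatim
by the items: Cfg/G/ε/τ/S/ldir/lpair/lstep as in route SpecularLambertianSwap, dstep (coin true ⇒
Lambertian lstep, coin false ⇒ the specular step cstep = `Alexander.collisionStep` by rfl),
dstate/dinst/dflow = iteration, collision instants and right-continuous flow exactly as
`Alexander.stateAfter/collisionInstant/fwdFlow` (τ = freeExitTime and inc = incomingPairs inlined,
rfl), noise q = `Measure.infinitePi` of stdGaussian ⊗ `bernoulliMeasure true false q`, fld = the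
three tested fields, P N = localGibbsL -/
@[route_item "route-AtomisticToContinuum-VanishingNoise"]
def DiceContinuity : Prop :=
  let E3 := EuclideanSpace ℝ (Fin 3); let X3 := UnitAddTorus (Fin 3); let Cfg : ℕ → Type := fun N => Literature.Analysis.FluidPDE.Config (N + 1) (Fin 3) X3; let G := Literature.Analysis.FluidPDE.Torus.geometry (Fin 3); let ε := Literature.MathematicalPhysics.KineticTheory.hsDiameter; let τ : ℝ → (N : ℕ) → Cfg N → ENNReal := fun σ N z => sInf {t : ENNReal | t ≠ ⊤ ∧ Literature.Analysis.FluidPDE.freeFlight G t.toReal z ∉ Literature.Analysis.FluidPDE.hardSphereDomain G (N + 1) (ε σ N)}; let inc : ℝ → (N : ℕ) → Cfg N → Set (Fin (N + 1) × Fin (N + 1)) := fun σ N z => {p | p.1 < p.2 ∧ z ∈ Literature.Analysis.FluidPDE.contactSet G (N + 1) (ε σ N) p.1 p.2 ∧ Literature.Analysis.FluidPDE.IsIncoming G z p.1 p.2}; let S : ℝ → (N : ℕ) → Cfg N → Cfg N := fun t _ z => Literature.Analysis.FluidPDE.freeFlight G t z; let ld : E3 → E3 → E3 := fun ω ξ =>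 ‖‖ω‖⁻¹ • ω + ‖ξ‖⁻¹ • ξ‖⁻¹ • (‖ω‖⁻¹ • ω + ‖ξ‖⁻¹ • ξ); let lp : (N : ℕ) → Fin (N + 1) → Fin (N + 1) → Cfg N → E3 → Cfg N := fun _ i j z ξ => let c := (2 : ℝ)⁻¹ • ((z i).2 + (z j).2); let w := (‖(z i).2 - (z j).2‖ / 2) • ld (G.sepVec (z i).1 (z j).1) ξ; Function.update (Function.update z i ((z i).1, c + w)) j ((z j).1, c - w); let lst : ℝ → (N : ℕ) → E3 → Cfg N → Cfg N := fun σ N ξ z => let z' := S (τ σ N z).toReal N z; if τ σ N z = ⊤ then z else if h : (inc σ N z').Nonempty then lp N h.some.1 h.some.2 z' ξ else z'; let cst : ℝ → (N : ℕ) → Cfg N → Cfg N := fun σ N z => if τ σ N z = ⊤ then z else (let z' := S (τ σ N z).toReal N z; if h : (inc σ N z').Nonempty then Literature.Analysis.FluidPDE.collidePair G h.some.1 h.some.2 z' else z'); let dsp : ℝ → (N : ℕ) → E3 × Bool → Cfg N → Cfg N := fun σ N ξ z => bif ξ.2 then lst σ N ξ.1 z else cst σ N z; let dst : ℝ → (N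 : ℕ) → (ℕ → E3 × Bool) → Cfg N → ℕ → Cfg N := fun σ N ξs z k => ((fun p : Cfg N × ℕ => (dsp σ N (ξs p.2) p.1, p.2 + 1))^[k] (z, 0)).1; let din : ℝ → (N : ℕ) → (ℕ → E3 × Bool) → Cfg N → ℕ → ENNReal := fun σ N ξs z k => ∑ m ∈ Finset.range k, τ σ N (dst σ N ξs z m); let dfl : ℝ → (N : ℕ) → (ℕ → E3 × Bool) → Cfg N → ℝ → Cfg N := fun σ N ξs z t => let K := sSup {k : ℕ | din σ N ξs z k ≤ ENNReal.ofReal t}; S (t - (din σ N ξs z K).toReal) N (dst σ N ξs z K); let nz : unitInterval → MeasureTheory.Measure (ℕ → E3 × Bool) := fun q => MeasureTheory.Measure.infinitePi (fun _ : ℕ => (ProbabilityTheory.stdGaussian (E3)).prod (ProbabilityTheory.bernoulliMeasure true false q)); let fld : (N : ℕ) → Cfg N → ((X3) → ℝ) → ℝ × (E3) × ℝ := fun _ z χ => (Literature.MathematicalPhysics.KineticTheory.empiricalDensityField z χ, Literature.MathematicalPhysics.KineticTheory.empiricalMomentumField z χ, Literature.MathematicalPhysics.KineticTheory.empiricalEnergyField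 z χ); ∀ (a₀ θ₀ : (X3) → ℝ) (u₀ : (X3) → E3), Continuous a₀ → Continuous θ₀ → Continuous u₀ → (∀ x, 0 < a₀ x) → (∀ x, 0 < θ₀ x) → ∃ σ₀ : ℝ, 0 < σ₀ ∧ ∀ σ : ℝ, 0 < σ → σ < σ₀ → ∀ (T : ℝ) (ρ θ : ℝ → (X3) → ℝ) (u : ℝ → (X3) → E3), Literature.MathematicalPhysics.KineticTheory.IsHardSphereEulerSolution σ T ρ u θ → ∀ Φ : (N : ℕ) → Literature.Analysis.FluidPDE.HardSphereFlow G (ε σ N) (N + 1), let P := fun N => Literature.MathematicalPhysics.KineticTheory.localGibbsLaw σ a₀ u₀ θ₀ N (Φ N); Literature.MathematicalPhysics.KineticTheory.TendstoHydroFieldsAt P Φ ρ u θ 0 → ∀ t ∈ Set.Ico 0 T, ∀ χ : (X3) → ℝ, Continuous χ → ∀ F : ℝ × (E3) × ℝ → ℝ, LipschitzWith 1 F → (∀ y, |F y| ≤ 1) → ∀ q : ℕ → unitInterval, Filter.Tendsto (fun N => (q N : ℝ)) Filter.atTop (nhds 0) → Filter.Tendsto (fun N : ℕ => (∫ z, F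 (fld N ((Φ N).flow t z) χ) ∂(P N)) - ∫ p, F (fld N (dfl σ N p.2 p.1 t) χ) ∂((P N).prod (nz (q N)))) Filter.atTop (nhds 0)

/-- item stmt-AtomisticToContinuum-8722 · crux · rank 3 · open · by planner
why it might fail: OVY's step (B) used bulk exchange noise at θ→∞ on all near pairs; contact-only angular dice with deterministic partner selection are degenerate, LiveraniOlla1996 Thm 1.2 excludes |v|²/2, and the cubic energy current needs the unproved high-momentum input.
sources: OllaVaradhanYau1993, LiveraniOlla1996, FritzFunakiLebowitz1994, doi:10.1007/s00205-008-0120-x, Rezakhanlou2003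
[crux] OVY AT A VANISHING FRACTION OF RANDOMISED COLLISIONS (OllaVaradhanYau1993 Thm 2.1 / Cor. 2.2
p. 531 transplanted; base case of the line). For every dice schedule with q_N → 0 and q_N
(N+1)^(1/3) → ∞ (OVY's θ(ε) → ∞, εθ(ε) → 0, p. 527): for continuous profiles ∃σ₀ ∀σ < σ₀ ∀ classical
hs-Euler solution on [0,T) ∀Φ, local Gibbs data with converging fields at t = 0 ⇒ for every t < T,
continuous χ and δ > 0 the (P_N ⊗ noise(q_N))-probability that the χ-tested density / momentum /
energy field of dflow_t deviates by more than δ from ∫χρ_t, ∫χρ_t u_t, ∫χE_t tends to 0. Same EOS p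
= ρθZ(ρσ³) (Gibbs laws are dice-invariant for every q: the flux-weighted cosine kernel is
self-dual). New versus print: (a) collisional hard-core entropy bookkeeping, (b) true kinetic energy
|v|²/2 (the board's shared velocity-tail input), (c) step (B) of the local ergodic theorem from
CONTACT angular dice on a vanishing fraction of collisions with quadratic kinetic energy. (why it
might fail: OVY's step (B) used bulk exchange noise at θ→∞ on all near pairs; contact-only angular
dice with deterministic partner selection are degenerate, LiveraniOlla1996 Thm 1.2 excludes |v|²/2,
and the cubic energy current -/
@[route_item "route-AtomisticToContinuum-VanishingNoise"]
def RareDiceEuler : Prop :=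
  let E3 := EuclideanSpace ℝ (Fin 3); let X3 := UnitAddTorus (Fin 3); let Cfg : ℕ → Type := fun N => Literature.Analysis.FluidPDE.Config (N + 1) (Fin 3) X3; let G := Literature.Analysis.FluidPDE.Torus.geometry (Fin 3); let ε := Literature.MathematicalPhysics.KineticTheory.hsDiameter; let τ : ℝ → (N : ℕ) → Cfg N → ENNReal := fun σ N z => sInf {t : ENNReal | t ≠ ⊤ ∧ Literature.Analysis.FluidPDE.freeFlight G t.toReal z ∉ Literature.Analysis.FluidPDE.hardSphereDomain G (N + 1) (ε σ N)}; let inc : ℝ → (N : ℕ) → Cfg N → Set (Fin (N + 1) × Fin (N + 1)) := fun σ N z => {p | p.1 < p.2 ∧ z ∈ Literature.Analysis.FluidPDE.contactSet G (N + 1) (ε σ N) p.1 p.2 ∧ Literature.Analysis.FluidPDE.IsIncoming G z p.1 p.2}; let S : ℝ → (N : ℕ) → Cfg N → Cfg N := fun t _ z => Literature.Analysis.FluidPDE.freeFlight G t z; let ld : E3 → E3 → E3 := fun ω ξ => ‖‖ω‖⁻¹ • ω + ‖ξ‖⁻¹ • ξ‖⁻¹ • (‖ω‖⁻¹ • ω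 + ‖ξ‖⁻¹ • ξ); let lp : (N : ℕ) → Fin (N + 1) → Fin (N + 1) → Cfg N → E3 → Cfg N := fun _ i j z ξ => let c := (2 : ℝ)⁻¹ • ((z i).2 + (z j).2); let w := (‖(z i).2 - (z j).2‖ / 2) • ld (G.sepVec (z i).1 (z j).1) ξ; Function.update (Function.update z i ((z i).1, c + w)) j ((z j).1, c - w); let lst : ℝ → (N : ℕ) → E3 → Cfg N → Cfg N := fun σ N ξ z => let z' := S (τ σ N z).toReal N z; if τ σ N z = ⊤ then z else if h : (inc σ N z').Nonempty then lp N h.some.1 h.some.2 z' ξ else z'; let cst : ℝ → (N : ℕ) → Cfg N → Cfg N := fun σ N z => if τ σ N z = ⊤ then z else (let z' := S (τ σ N z).toReal N z; if h : (inc σ N z').Nonempty then Literature.Analysis.FluidPDE.collidePair G h.some.1 h.some.2 z' else z'); let dsp : ℝ → (N : ℕ) → E3 × Bool → Cfg N → Cfg N := fun σ N ξ z => bif ξ.2 then lst σ N ξ.1 z else cst σ N z; let dst : ℝ → (N : ℕ) → (ℕ → E3 × Bool) → Cfg N → ℕ → Cfg N := fun σ N ξs z k => ((fun p : Cfg N ×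 ℕ => (dsp σ N (ξs p.2) p.1, p.2 + 1))^[k] (z, 0)).1; let din : ℝ → (N : ℕ) → (ℕ → E3 × Bool) → Cfg N → ℕ → ENNReal := fun σ N ξs z k => ∑ m ∈ Finset.range k, τ σ N (dst σ N ξs z m); let dfl : ℝ → (N : ℕ) → (ℕ → E3 × Bool) → Cfg N → ℝ → Cfg N := fun σ N ξs z t => let K := sSup {k : ℕ | din σ N ξs z k ≤ ENNReal.ofReal t}; S (t - (din σ N ξs z K).toReal) N (dst σ N ξs z K); let nz : unitInterval → MeasureTheory.Measure (ℕ → E3 × Bool) := fun q => MeasureTheory.Measure.infinitePi (fun _ : ℕ => (ProbabilityTheory.stdGaussian (E3)).prod (ProbabilityTheory.bernoulliMeasure true false q)); ∀ q : ℕ → unitInterval, Filter.Tendsto (fun N => (q N : ℝ)) Filter.atTop (nhds 0) → Filter.Tendsto (fun N : ℕ => (q N : ℝ) * ((N : ℝ) + 1) ^ (1 / 3 : ℝ)) Filter.atTop Filter.atTop → ∀ (a₀ θ₀ : (X3) → ℝ) (u₀ : (X3) → E3), Continuous a₀ → Continuous θ₀ → Continuous u₀ → (∀ x, 0 < a₀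 x) → (∀ x, 0 < θ₀ x) → ∃ σ₀ : ℝ, 0 < σ₀ ∧ ∀ σ : ℝ, 0 < σ → σ < σ₀ → ∀ (T : ℝ) (ρ θ : ℝ → (X3) → ℝ) (u : ℝ → (X3) → E3), Literature.MathematicalPhysics.KineticTheory.IsHardSphereEulerSolution σ T ρ u θ → ∀ Φ : (N : ℕ) → Literature.Analysis.FluidPDE.HardSphereFlow G (ε σ N) (N + 1), let P := fun N => Literature.MathematicalPhysics.KineticTheory.localGibbsLaw σ a₀ u₀ θ₀ N (Φ N); Literature.MathematicalPhysics.KineticTheory.TendstoHydroFieldsAt P Φ ρ u θ 0 → ∀ t ∈ Set.Ico 0 T, ∀ χ : (X3) → ℝ, Continuous χ → ∀ δ > (0 : ℝ), Filter.Tendsto (fun N : ℕ => ((P N).prod (nz (q N))) {p | δ < |Literature.MathematicalPhysics.KineticTheory.empiricalDensityField (dfl σ N p.2 p.1 t) χ - ∫ x, χ x * ρ t x|}) Filter.atTop (nhds 0) ∧ Filter.Tendsto (fun N : ℕ => ((P N).prod (nz (q N))) {p | δ < ‖Literature.MathematicalPhysics.KineticTheory.empiricalMomentumField (dfl σ N p.2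 p.1 t) χ - ∫ x, (χ x * ρ t x) • u t x‖}) Filter.atTop (nhds 0) ∧ Filter.Tendsto (fun N : ℕ => ((P N).prod (nz (q N))) {p | δ < |Literature.MathematicalPhysics.KineticTheory.empiricalEnergyField (dfl σ N p.2 p.1 t) χ - ∫ x, χ x * Literature.MathematicalPhysics.KineticTheory.totalEnergyDensity (ρ t x) (u t x) (θ t x)|}) Filter.atTop (nhds 0)

/-- item stmt-AtomisticToContinuum-8724 · crux · rank 4 · open · by planner
why it might fail: pathwise one flipped coin decorrelates a sound cone of ≍N·s³ particles within O(log N) collision times; the O(N^(-4/3)) law-level bound needs the future field law to forget a local measure-preserving surgery of the time-t_k law — false if f_t carries macroscopically relevant fine structure.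
sources: Grimmett2018, Russo1981, BenjaminiKalaiSchramm1999, arXiv:1210.1261, Chatterjee2006
[crux] THE INFLUENCE BUDGET (Russo / pivotality form; first child of the foreseen split of
DiceContinuity, filed now because it is typable and kit-testable). Same frame as DiceContinuity; for
t < T, χ, F there are C, q₀ > 0, N₀ such that for N ≥ N₀, every q ≤ q₀ and every K: Σ_(k<K) |E_(P_N
⊗ noise(q)) [F(fields(dflow_t, coin_k := true)) − F(fields(dflow_t, coin_k := false))]| ≤ C — the
summed law-level influence of re-randomising single collisions is O(1) (≍N^(4/3)·t collisions, so
O(N^(-4/3)) on average: the size that exact pair conservation at distance ε_N gives at the final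
time, |Δm_χ| ≤ ‖∇χ‖ ε_N |g|/(N+1)). By Russo's formula (Grimmett2018 Thm 4.66, Ex. 4.9) the sum is
dE_q F/dq, so sup_(q ≤ q₀) |dE_q/dq| ≤ C, |Δ_N(q)| ≤ C·q and DiceContinuity follows (glue, layer 2).
Contrast SwapGap of SpecularLambertianSwap: there all ≍N^(4/3) swaps are made and o(N^(-4/3)) per
swap (cancellation) is needed; here only the bound, because q_N → 0 pays. (why it might fail:
pathwise one flipped coin decorrelates a sound cone of ≍N·s³ particles within O(log N) collision
times; the O(N^(-4/3)) law-level bound needs the future field law to forget a local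
measure-preserving surgery of the time-t_k -/
@[route_item "route-AtomisticToContinuum-VanishingNoise"]
def CoinInfluence : Prop :=
  let E3 := EuclideanSpace ℝ (Fin 3); let X3 := UnitAddTorus (Fin 3); let Cfg : ℕ → Type := fun N => Literature.Analysis.FluidPDE.Config (N + 1) (Fin 3) X3; let G := Literature.Analysis.FluidPDE.Torus.geometry (Fin 3); let ε := Literature.MathematicalPhysics.KineticTheory.hsDiameter; let τ : ℝ → (N : ℕ) → Cfg N → ENNReal := fun σ N z => sInf {t : ENNReal | t ≠ ⊤ ∧ Literature.Analysis.FluidPDE.freeFlight G t.toReal z ∉ Literature.Analysis.FluidPDE.hardSphereDomain G (N + 1) (ε σ N)}; let inc : ℝ → (N : ℕ) → Cfg N → Set (Fin (N + 1) × Fin (N + 1)) := fun σ N z => {p | p.1 < p.2 ∧ z ∈ Literature.Analysis.FluidPDE.contactSet G (N + 1) (ε σ N) p.1 p.2 ∧ Literature.Analysis.FluidPDE.IsIncoming G z p.1 p.2}; let S : ℝ → (N : ℕ) → Cfg N → Cfg N := fun t _ z => Literature.Analysis.FluidPDE.freeFlight G t z; let ld : E3 → E3 → E3 := fun ω ξ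 => ‖‖ω‖⁻¹ • ω + ‖ξ‖⁻¹ • ξ‖⁻¹ • (‖ω‖⁻¹ • ω + ‖ξ‖⁻¹ • ξ); let lp : (N : ℕ) → Fin (N + 1) → Fin (N + 1) → Cfg N → E3 → Cfg N := fun _ i j z ξ => let c := (2 : ℝ)⁻¹ • ((z i).2 + (z j).2); let w := (‖(z i).2 - (z j).2‖ / 2) • ld (G.sepVec (z i).1 (z j).1) ξ; Function.update (Function.update z i ((z i).1, c + w)) j ((z j).1, c - w); let lst : ℝ → (N : ℕ) → E3 → Cfg N → Cfg N := fun σ N ξ z => let z' := S (τ σ N z).toReal N z; if τ σ N z = ⊤ then z else if h : (inc σ N z').Nonempty then lp N h.some.1 h.some.2 z' ξ else z'; let cst : ℝ → (N : ℕ) → Cfg N → Cfg N := fun σ N z => if τ σ N z = ⊤ then z else (let z' := S (τ σ N z).toReal N z; if h : (inc σ N z').Nonempty then Literature.Analysis.FluidPDE.collidePair G h.some.1 h.some.2 z' else z'); let dsp : ℝ → (N : ℕ) → E3 × Bool → Cfg N → Cfg N := fun σ N ξ z => bif ξ.2 then lst σ N ξ.1 z else cst σ N z; let dst : ℝ → (N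 : ℕ) → (ℕ → E3 × Bool) → Cfg N → ℕ → Cfg N := fun σ N ξs z k => ((fun p : Cfg N × ℕ => (dsp σ N (ξs p.2) p.1, p.2 + 1))^[k] (z, 0)).1; let din : ℝ → (N : ℕ) → (ℕ → E3 × Bool) → Cfg N → ℕ → ENNReal := fun σ N ξs z k => ∑ m ∈ Finset.range k, τ σ N (dst σ N ξs z m); let dfl : ℝ → (N : ℕ) → (ℕ → E3 × Bool) → Cfg N → ℝ → Cfg N := fun σ N ξs z t => let K := sSup {k : ℕ | din σ N ξs z k ≤ ENNReal.ofReal t}; S (t - (din σ N ξs z K).toReal) N (dst σ N ξs z K); let nz : unitInterval → MeasureTheory.Measure (ℕ → E3 × Bool) := fun q => MeasureTheory.Measure.infinitePi (fun _ : ℕ => (ProbabilityTheory.stdGaussian (E3)).prod (ProbabilityTheory.bernoulliMeasure true false q)); let fld : (N : ℕ) → Cfg N → ((X3) → ℝ) → ℝ × (E3) × ℝ := fun _ z χ => (Literature.MathematicalPhysics.KineticTheory.empiricalDensityField z χ, Literature.MathematicalPhysics.KineticTheory.empiricalMomentumField z χ, Literature.MathematicalPhysics.KineticTheory.empiricalEnergyField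 z χ); ∀ (a₀ θ₀ : (X3) → ℝ) (u₀ : (X3) → E3), Continuous a₀ → Continuous θ₀ → Continuous u₀ → (∀ x, 0 < a₀ x) → (∀ x, 0 < θ₀ x) → ∃ σ₀ : ℝ, 0 < σ₀ ∧ ∀ σ : ℝ, 0 < σ → σ < σ₀ → ∀ (T : ℝ) (ρ θ : ℝ → (X3) → ℝ) (u : ℝ → (X3) → E3), Literature.MathematicalPhysics.KineticTheory.IsHardSphereEulerSolution σ T ρ u θ → ∀ Φ : (N : ℕ) → Literature.Analysis.FluidPDE.HardSphereFlow G (ε σ N) (N + 1), let P := fun N => Literature.MathematicalPhysics.KineticTheory.localGibbsLaw σ a₀ u₀ θ₀ N (Φ N); Literature.MathematicalPhysics.KineticTheory.TendstoHydroFieldsAt P Φ ρ u θ 0 → ∀ t ∈ Set.Ico 0 T, ∀ χ : (X3) → ℝ, Continuous χ → ∀ F : ℝ × (E3) × ℝ → ℝ, LipschitzWith 1 F → (∀ y, |F y| ≤ 1) → ∃ C : ℝ, ∃ q₀ : ℝ, 0 < q₀ ∧ ∃ N₀ : ℕ, ∀ N ≥ N₀, ∀ q : unitInterval, (q : ℝ)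 ≤ q₀ → ∀ K : ℕ, ∑ k ∈ Finset.range K, |∫ p, (F (fld N (dfl σ N (Function.update p.2 k ((p.2 k).1, true)) p.1 t) χ) - F (fld N (dfl σ N (Function.update p.2 k ((p.2 k).1, false)) p.1 t) χ)) ∂((P N).prod (nz q))| ≤ C

/-- item stmt-AtomisticToContinuum-0766 · support · rank 0 · open · by planner
why it might fail: it is the conjunct in Yau's entropy form: entropy production >= cN before the first shock for some smooth data would refute it and every entropy route at once
sources: Yau1991, OllaVaradhanYau1993, KipnisLandim1999
[target] X_RE: for all continuous profiles ∃ σ₀ ∀ σ<σ₀ ∀ classical hs-Euler solutions on [0,T) ∀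
flows: the initial local Gibbs laws are probability measures and, if their fields converge at t=0,
then ∀ t<T ∃ activity profile a_t such that the reference local Gibbs law (a_t, u_t, θ_t) is a
probability measure whose empirical density/momentum/energy fields concentrate exponentially (≤ C
e^{-(N+1)/C}) around (ρ,ρu,E)(t), and klDiv(lawAt Φ_N (localGibbs a₀u₀θ₀) t ‖ localGibbs a_t u_t
θ_t)/(N+1) → 0. Yau1991; OllaVaradhanYau1993 Thm 1.1 (with noise). -/
@[route_item "route-AtomisticToContinuum-VanishingNoise"]
def RelEntropyVanishing : Prop :=
  ∀ (a₀ θ₀ : Literature.MathematicalPhysics.KineticTheory.T3 → ℝ) (u₀ : Literature.MathematicalPhysics.KineticTheory.T3 → Literature.MathematicalPhysics.KineticTheory.V3), Continuous a₀ → Continuous θ₀ → Continuous u₀ → (∀ x, 0 < a₀ x) → (∀ x, 0 < θ₀ x) → ∃ σ₀ : ℝ, 0 < σ₀ ∧ ∀ σ : ℝ, 0 < σ → σ < σ₀ → ∀ (T : ℝ) (ρ θ : ℝ → Literature.MathematicalPhysics.KineticTheory.T3 → ℝ) (u : ℝ → Literature.MathematicalPhysics.KineticTheory.T3 → Literature.MathematicalPhysics.KineticTheory.V3),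 Literature.MathematicalPhysics.KineticTheory.IsHardSphereEulerSolution σ T ρ u θ → ∀ Φ : (N : ℕ) → Literature.Analysis.FluidPDE.HardSphereFlow (Literature.Analysis.FluidPDE.Torus.geometry (Fin 3)) (Literature.MathematicalPhysics.KineticTheory.hsDiameter σ N) (N + 1), (∀ N, MeasureTheory.IsProbabilityMeasure (Literature.MathematicalPhysics.KineticTheory.localGibbsLaw σ a₀ u₀ θ₀ N (Φ N))) ∧ (Literature.MathematicalPhysics.KineticTheory.TendstoHydroFieldsAt (fun N => Literature.MathematicalPhysics.KineticTheory.localGibbsLaw σ a₀ u₀ θ₀ N (Φ N)) Φ ρ u θ 0 → ∀ t ∈ Set.Ico 0 T, ∃ a : Literature.MathematicalPhysics.KineticTheory.T3 → ℝ, (∀ N, MeasureTheory.IsProbabilityMeasure (Literature.MathematicalPhysics.KineticTheory.localGibbsLaw σ a (u t) (θ t) N (Φ N))) ∧ (∀ χ : Literature.MathematicalPhysics.KineticTheory.T3 → ℝ, Continuous χ → ∀ δ : ℝ, 0 < δ → ∃ C : ℝ, 0 < C ∧ ∀ N : ℕ, Literature.MathematicalPhysics.KineticTheory.localGibbsLaw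 σ a (u t) (θ t) N (Φ N) {z | δ < |Literature.MathematicalPhysics.KineticTheory.empiricalDensityField z χ - ∫ x, χ x * ρ t x|} ≤ ENNReal.ofReal (C * Real.exp (-(C⁻¹ * (N + 1)))) ∧ Literature.MathematicalPhysics.KineticTheory.localGibbsLaw σ a (u t) (θ t) N (Φ N) {z | δ < ‖Literature.MathematicalPhysics.KineticTheory.empiricalMomentumField z χ - ∫ x, (χ x * ρ t x) • u t x‖} ≤ ENNReal.ofReal (C * Real.exp (-(C⁻¹ * (N + 1)))) ∧ Literature.MathematicalPhysics.KineticTheory.localGibbsLaw σ a (u t) (θ t) N (Φ N) {z | δ < |Literature.MathematicalPhysics.KineticTheory.empiricalEnergyField z χ - ∫ x, χ x * Literature.MathematicalPhysics.KineticTheory.totalEnergyDensity (ρ t x) (u t x) (θ t x)|} ≤ ENNReal.ofReal (C * Real.exp (-(C⁻¹ * (N + 1))))) ∧ Filter.Tendsto (fun N : ℕ => InformationTheory.klDiv ((Φ N).lawAt (Literature.MathematicalPhysics.KineticTheory.localGibbsLaw σ a₀ u₀ θ₀ N (Φ N)) t) (Literature.MathematicalPhysics.KineticTheory.localGibbsLaw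 σ a (u t) (θ t) N (Φ N)) / ((N : ENNReal) + 1)) Filter.atTop (nhds 0))

-- item stmt-AtomisticToContinuum-0811 · support · rank 2 · open · by planner — informal only, no Lean statement yet:
--   [crux] QUANTITATIVE OVY WITH VANISHING NOISE: for N+1 hard spheres of diameter σ(N+1)^{-1/3} on 𝕋³
--   (σ < σ₀, local Gibbs data a₀,u₀,θ₀) whose flow is superposed with OVY conservative velocity-exchange
--   noise of intensity γ (jumps (v_i,v_j) ↦ random rotation in the pair centre-of-mass frame for pairs
--   at distance < r·ε, r fixed; conserves particle number, momentum, kinetic energy locally), and a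
--   classical hs-Euler solution on [0,T): for t < T the specific relative entropy of the time-t law
--   w.r.t. the local Gibbs state with parameters (a(ρ_t,σ), u_t, θ_t) satisfies H^γ_N(t)/(N+1) ≤
--   C(T,data)·(γ^{-a

-- item stmt-AtomisticToContinuum-0812 · support · rank 3 · open · by planner — informal only, no Lean statement yet:
--   [crux] STOCHASTIC STABILITY OF THE MACROSCOPIC FIELDS: with γ_N → 0 as produced by
--   UniformInNoiseEntropy (any γ_N ≤ N^{-k} suffices to make the route close), for local Gibbs data, σ <
--   σ₀, t < T, continuous χ and δ > 0: |P^{γ_N}_N{δ < |field_χ(z(t)) − target|} − P^{0}_N{δ <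
--   |field_χ(Φ_N,t z) − target|}| → 0 for the three fields, where P^γ is the law of the noisy process
--   and P^0 = localGibbsLaw pushed by the deterministic HardSphereFlow. Route content: law-level
--   insensitivity of hydrodynamic observables to a vanishing fraction of randomised collisions despite
--   exponential trajectory instability (

-- item stmt-AtomisticToContinuum-0813 · support · rank 4 · open · by planner — informal only, no Lean statement yet:
--   [crux] OVY FOR HARD SPHERES AT FIXED NOISE: for every fixed γ > 0 the conclusion of
--   HydrodynamicLimitFor σ (σ < σ₀(profiles)) holds for the noisy hard-sphere dynamics of
--   UniformInNoiseEntropy in place of the deterministic flow — OllaVaradhanYau1993 Thm 1.1 transplanted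
--   from smooth finite-range Hamiltonians with modified (bounded-velocity) kinetic energy to elastic
--   hard-sphere collisions with the true kinetic energy |v|²/2 and EOS p = ρθZ(ρσ³). Base case of the
--   route; the two genuinely new points are the collisional (non-smooth) dynamics in the entropy
--   computation and the cubic velocity moments

/-- item stmt-AtomisticToContinuum-8691 · support · rank 9 · open · by planner
[support] q = 0 IS THE CONJUNCT'S GAS: for 0 < σ < 1/2, every N, every HardSphereFlow Φ and t ≥ 0,
for Liouville ⊗ noise(0)-a.e. (z, ξ): dflow_t(z, ξ) = Φ_t z (bernoulliMeasure_zero: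
Ber(true,false;0) = δ_false, so every coin is specular, dstep = cstep = `Alexander.collisionStep`
(rfl), dstate = stateAfter, dinst = collisionInstant, dflow = fwdFlow = `Alexander.flow` for t ≥ 0;
then HardSphereFlow.flow_eq_ae_holds with nonempty_torus_holds' constructed flow). Transfers to P_N
≪ Liouville (lawAt_withDensity_holds); it is the q = 0 content of DiceContinuity and the unit test
of the dice block. [difficulty: provable-now] [GST2013, CIP1994] -/
@[route_item "route-AtomisticToContinuum-VanishingNoise"]
def DiceAtZero : Prop :=
  let E3 := EuclideanSpace ℝ (Fin 3); let X3 := UnitAddTorus (Fin 3); let Cfg : ℕ → Type := fun N => Literature.Analysis.FluidPDE.Config (N + 1) (Fin 3) X3; let G := Literature.Analysis.FluidPDE.Torus.geometry (Fin 3); let ε := Literature.MathematicalPhysics.KineticTheory.hsDiameter; let τ : ℝ → (N : ℕ) → Cfg N → ENNReal := fun σ N z => sInf {t : ENNReal | t ≠ ⊤ ∧ Literature.Analysis.FluidPDE.freeFlight G t.toReal z ∉ Literature.Analysis.FluidPDE.hardSphereDomain G (N + 1) (ε σ N)}; let inc : ℝ → (N : ℕ) → Cfg N → Set (Fin (N +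 1) × Fin (N + 1)) := fun σ N z => {p | p.1 < p.2 ∧ z ∈ Literature.Analysis.FluidPDE.contactSet G (N + 1) (ε σ N) p.1 p.2 ∧ Literature.Analysis.FluidPDE.IsIncoming G z p.1 p.2}; let S : ℝ → (N : ℕ) → Cfg N → Cfg N := fun t _ z => Literature.Analysis.FluidPDE.freeFlight G t z; let ld : E3 → E3 → E3 := fun ω ξ => ‖‖ω‖⁻¹ • ω + ‖ξ‖⁻¹ • ξ‖⁻¹ • (‖ω‖⁻¹ • ω + ‖ξ‖⁻¹ • ξ); let lp : (N : ℕ) → Fin (N + 1) → Fin (N + 1) → Cfg N → E3 → Cfg N := fun _ i j z ξ => let c := (2 : ℝ)⁻¹ • ((z i).2 + (z j).2); let w := (‖(z i).2 - (z j).2‖ / 2) • ld (G.sepVec (z i).1 (z j).1) ξ; Function.update (Function.update z i ((z i).1, c + w)) j ((z j).1, c - w); let lst : ℝ → (N : ℕ) → E3 → Cfg N → Cfg N := fun σ N ξ z => let z' := S (τ σ N z).toReal N z; if τ σ N z = ⊤ then z else if h : (inc σ N z').Nonempty then lp N h.some.1 h.some.2 z' ξ else z'; let cst : ℝ → (N :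 ℕ) → Cfg N → Cfg N := fun σ N z => if τ σ N z = ⊤ then z else (let z' := S (τ σ N z).toReal N z; if h : (inc σ N z').Nonempty then Literature.Analysis.FluidPDE.collidePair G h.some.1 h.some.2 z' else z'); let dsp : ℝ → (N : ℕ) → E3 × Bool → Cfg N → Cfg N := fun σ N ξ z => bif ξ.2 then lst σ N ξ.1 z else cst σ N z; let dst : ℝ → (N : ℕ) → (ℕ → E3 × Bool) → Cfg N → ℕ → Cfg N := fun σ N ξs z k => ((fun p : Cfg N × ℕ => (dsp σ N (ξs p.2) p.1, p.2 + 1))^[k] (z, 0)).1; let din : ℝ → (N : ℕ) → (ℕ → E3 × Bool) → Cfg N → ℕ → ENNReal := fun σ N ξs z k => ∑ m ∈ Finset.range k, τ σ N (dst σ N ξs z m); let dfl : ℝ → (N : ℕ) → (ℕ → E3 × Bool) → Cfg N → ℝ → Cfg N := fun σ N ξs z t => let K := sSup {k : ℕ | din σ N ξs z k ≤ ENNReal.ofReal t}; S (t - (din σ N ξs z K).toReal) N (dst σ N ξs z K); let nz : unitInterval → MeasureTheory.Measure (ℕ → E3 × Bool) := fun q => MeasureTheory.Measure.infinitePi (fun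 _ : ℕ => (ProbabilityTheory.stdGaussian (E3)).prod (ProbabilityTheory.bernoulliMeasure true false q)); ∀ σ : ℝ, 0 < σ → σ < 2⁻¹ → ∀ (N : ℕ) (Φ : Literature.Analysis.FluidPDE.HardSphereFlow G (ε σ N) (N + 1)) (t : ℝ), 0 ≤ t → ∀ᵐ p ∂((Literature.Analysis.FluidPDE.liouville G (N + 1) (ε σ N)).prod (nz 0)), dfl σ N p.2 p.1 t = Φ.flow t p.1

/-- item stmt-AtomisticToContinuum-8705 · support · rank 9 · open · by planner
[support] ALEXANDER FOR THE DICE GAS: for 0 < σ < 1/2, every N and every q, (z, ξ) ↦ dflow_t(z, ξ)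
is measurable for each t, and for Liouville ⊗ noise(q)-a.e. (z, ξ) every finite exit configuration
of the coin/ξ-driven recursion is a simple incoming collision, no pair touches strictly inside a
free flight, and the exit times sum to ∞ (the three FwdGood clauses for dstate). Same
flux/measure-preservation argument as torusFlow_ae_good_holds / torusFlow_measurable_holds and as
LambertianWellPosed (stmt-AtomisticToContinuum-4442): both the specular reflection and the cosine
redraw map the incoming flux measure |g·ω|dS onto the outgoing one. [difficulty: M] [GST2013,
CIP1994, doi:10.1007/s00205-008-0120-x] -/
@[route_item "route-AtomisticToContinuum-VanishingNoise"]
def DiceWellPosed : Prop :=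
  let E3 := EuclideanSpace ℝ (Fin 3); let X3 := UnitAddTorus (Fin 3); let Cfg : ℕ → Type := fun N => Literature.Analysis.FluidPDE.Config (N + 1) (Fin 3) X3; let G := Literature.Analysis.FluidPDE.Torus.geometry (Fin 3); let ε := Literature.MathematicalPhysics.KineticTheory.hsDiameter; let τ : ℝ → (N : ℕ) → Cfg N → ENNReal := fun σ N z => sInf {t : ENNReal | t ≠ ⊤ ∧ Literature.Analysis.FluidPDE.freeFlight G t.toReal z ∉ Literature.Analysis.FluidPDE.hardSphereDomain G (N + 1) (ε σ N)}; let inc : ℝ → (N : ℕ) → Cfg N → Set (Fin (N + 1) × Fin (N + 1)) := fun σ N z => {p | p.1 < p.2 ∧ z ∈ Literature.Analysis.FluidPDE.contactSet G (N + 1) (ε σ N) p.1 p.2 ∧ Literature.Analysis.FluidPDE.IsIncoming G z p.1 p.2}; let S : ℝ → (N : ℕ) → Cfg N → Cfg N := fun t _ z => Literature.Analysis.FluidPDE.freeFlight G t z; let ld : E3 → E3 → E3 := fun ω ξ => ‖‖ω‖⁻¹ • ω + ‖ξ‖⁻¹ • ξ‖⁻¹ • (‖ω‖⁻¹ • ω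 + ‖ξ‖⁻¹ • ξ); let lp : (N : ℕ) → Fin (N + 1) → Fin (N + 1) → Cfg N → E3 → Cfg N := fun _ i j z ξ => let c := (2 : ℝ)⁻¹ • ((z i).2 + (z j).2); let w := (‖(z i).2 - (z j).2‖ / 2) • ld (G.sepVec (z i).1 (z j).1) ξ; Function.update (Function.update z i ((z i).1, c + w)) j ((z j).1, c - w); let lst : ℝ → (N : ℕ) → E3 → Cfg N → Cfg N := fun σ N ξ z => let z' := S (τ σ N z).toReal N z; if τ σ N z = ⊤ then z else if h : (inc σ N z').Nonempty then lp N h.some.1 h.some.2 z' ξ else z'; let cst : ℝ → (N : ℕ) → Cfg N → Cfg N := fun σ N z => if τ σ N z = ⊤ then z else (let z' := S (τ σ N z).toReal N z; if h : (inc σ N z').Nonempty then Literature.Analysis.FluidPDE.collidePair G h.some.1 h.some.2 z' else z'); let dsp : ℝ → (N : ℕ) → E3 × Bool → Cfg N → Cfg N := fun σ N ξ z => bif ξ.2 then lst σ N ξ.1 z else cst σ N z; let dst : ℝ → (N : ℕ) → (ℕ → E3 × Bool) → Cfg N → ℕ → Cfg N := fun σ N ξs z k => ((fun p : Cfg N ×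 ℕ => (dsp σ N (ξs p.2) p.1, p.2 + 1))^[k] (z, 0)).1; let din : ℝ → (N : ℕ) → (ℕ → E3 × Bool) → Cfg N → ℕ → ENNReal := fun σ N ξs z k => ∑ m ∈ Finset.range k, τ σ N (dst σ N ξs z m); let dfl : ℝ → (N : ℕ) → (ℕ → E3 × Bool) → Cfg N → ℝ → Cfg N := fun σ N ξs z t => let K := sSup {k : ℕ | din σ N ξs z k ≤ ENNReal.ofReal t}; S (t - (din σ N ξs z K).toReal) N (dst σ N ξs z K); let nz : unitInterval → MeasureTheory.Measure (ℕ → E3 × Bool) := fun q => MeasureTheory.Measure.infinitePi (fun _ : ℕ => (ProbabilityTheory.stdGaussian (E3)).prod (ProbabilityTheory.bernoulliMeasure true false q)); ∀ σ : ℝ, 0 < σ → σ < 2⁻¹ → ∀ (N : ℕ) (q : unitInterval), (∀ t : ℝ, Measurable (fun p : Cfg N × (ℕ → E3 × Bool) => dfl σ N p.2 p.1 t)) ∧ ∀ᵐ p ∂((Literature.Analysis.FluidPDE.liouville G (N + 1) (ε σ N)).prod (nz q)), (let L := dst σ N p.2 p.1; ((∀ k, τ σ N (L k) ≠ ⊤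 → (let y := S (τ σ N (L k)).toReal N (L k); ∃ p : Fin (N + 1) × Fin (N + 1), p.1 < p.2 ∧ Literature.Analysis.FluidPDE.IsIncoming G y p.1 p.2 ∧ ∀ i j : Fin (N + 1), i ≠ j → (y ∈ Literature.Analysis.FluidPDE.contactSet G (N + 1) (ε σ N) i j ↔ ({i, j} : Finset (Fin (N + 1))) = {p.1, p.2}))) ∧ (∀ k (s : ℝ), 0 < s → ENNReal.ofReal s < τ σ N (L k) → ∀ i j : Fin (N + 1), i ≠ j → S s N (L k) ∉ Literature.Analysis.FluidPDE.contactSet G (N + 1) (ε σ N) i j) ∧ ∑' k, τ σ N (L k) = ⊤))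

/-- item stmt-AtomisticToContinuum-0769 · assembly · rank 1 · open · by planner
[assembly] X_RE → HydrodynamicLimit: entropy inequality μ(A) ≤ (log 2 + H(μ|λ))/log(1 + 1/λ(A))
(from Donsker–Varadhan / Mathlib klDiv API) with λ(A) ≤ C e^{-(N+1)/C} and H = o(N) gives μ(A) → 0;
μ = lawAt (Φ N) P t = P.map (flow t) turns μ{z | δ < |field z − ·|} into P{z | δ < |field (flow t z)
− ·|} (measurable_flow); the reference concentration is stated for z itself and TendstoHydroFieldsAt
at time 0 of the reference law is not needed. Zero-mass case impossible by the IsProbabilityMeasure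
clauses; take σ₀ from X_RE. -/
@[route_item "route-AtomisticToContinuum-VanishingNoise"]
def Assembly : Prop :=
  RelEntropyVanishing → Literature.MathematicalPhysics.KineticTheory.HydrodynamicLimit

/-- item stmt-AtomisticToContinuum-8725 · assembly · rank 9 · open · by planner
[support] GLUE TO THE CONJUNCT — the intended Assembly of the repaired route, filed as a support
item because replacing the route's Assembly item (0769, shared entropy-inequality glue
RelEntropyVanishing → HydrodynamicLimit) needs the tenure planner/operator: DiceContinuity →
RareDiceEuler → HydrodynamicLimit. Portmanteau plumbing, provable now (same shape as route
SpecularLambertianSwap's assembly): fix profiles; dice schedule q_N := (N+1)^(-1/6) (q_N → 0, q_N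
(N+1)^(1/3) = (N+1)^(1/6) → ∞); σ₀ := min of the σ₀ of RareDiceEuler at this schedule and of
DiceContinuity; for σ < σ₀, a classical solution on [0,T), flows Φ, the t = 0 hypothesis and t < T,
χ, δ: with F(d,m,e) := min(1, (|d − ∫χρ_t| − δ/2)₊) (1-Lipschitz, 0 ≤ F ≤ 1, ≥ min(1,δ/2) on A_δ, =
0 off A_(δ/2)): min(1,δ/2)·P_N(A_δ(Φ_t)) ≤ ∫F∘fld∘Φ_t dP_N = [∫F∘fld∘Φ_t dP_N − ∫F∘fld∘dfl_t d(P_N ⊗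
nz(q_N))] + ∫F∘fld∘dfl_t d(P_N ⊗ nz(q_N)) ≤ o(1) (DiceContinuity along q_N) + (P_N ⊗
nz(q_N))(A_(δ/2)(dfl_t)) → 0 (RareDiceEuler with δ/2); likewise momentum and energy ⇒
TendstoHydroFieldsAt at every t < T ⇒ HydrodynamicLimitFor σ for σ < σ₀(profiles) ⇒ the conjunct
(hydrodynamicLimit_iff). [deps: DiceContinuity, RareDiceEuler] [difficul -/
@[route_item "route-AtomisticToContinuum-VanishingNoise"]
def Assembly2 : Prop :=
  DiceContinuity → RareDiceEuler → Literature.MathematicalPhysics.KineticTheory.HydrodynamicLimit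

/-! D-0027 §2.1 — DECIDING THEOREM (planner-authored via `route open/edit --closes-file`; by planner-rbadge-AtomisticToContinuum-VanishingN-5b62627e-g3-0 2026-08-16T06:07:24Z):
its hypotheses are this route's items and its conclusion the sub-problem Statement (glue_lint), and it elaborates with this file. -/

@[closes "route-AtomisticToContinuum-VanishingNoise"] theorem closes (h₁ : DiceContinuity) (h₂ : RareDiceEuler) : _root_.HydrodynamicLimit := by
  have key : ∀ {X Y : ℕ → Type} [∀ N, MeasurableSpace (X N)] [∀ N, MeasurableSpace (Y N)]
      (P : ∀ N, Measure (X N)) (μ : ∀ N, Measure (Y N))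
      (gX : ∀ N, X N → ℝ × EuclideanSpace ℝ (Fin 3) × ℝ) (gY : ∀ N, Y N → ℝ × EuclideanSpace ℝ (Fin 3) × ℝ),
      (∀ F : ℝ × EuclideanSpace ℝ (Fin 3) × ℝ → ℝ, LipschitzWith 1 F → (∀ y, |F y| ≤ 1) →
        Tendsto (fun N => (∫ x, F (gX N x) ∂P N) - ∫ y, F (gY N y) ∂μ N) atTop (𝓝 0)) →
      ∀ (dev : ℝ × EuclideanSpace ℝ (Fin 3) × ℝ → ℝ) {δ : ℝ}, 0 < δ → (∀ a b, |dev a - dev b| ≤ dist a b) →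
      (∀ N, IsFiniteMeasure (P N)) → (∀ N, IsFiniteMeasure (μ N)) → (∀ N, Measurable fun x => dev (gX N x)) →
      Tendsto (fun N => μ N {y | δ / 2 < dev (gY N y)}) atTop (𝓝 0) →
      Tendsto (fun N => P N {x | δ < dev (gX N x)}) atTop (𝓝 0) := by
    intro X Y _ _ P μ gX gY hH dev δ hδ hdev hP hμ hmeas hB
    have hm0 : 0 < min 1 (δ / 2) := lt_min one_pos (half_pos hδ)
    have hG0 : ∀ r : ℝ, 0 ≤ min 1 (max 0 (r - δ / 2)) := fun r => le_min zero_le_one (le_max_left _ _)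
    have hG1 : ∀ r : ℝ, min 1 (max 0 (r - δ / 2)) ≤ 1 := fun r => min_le_left _ _
    have hGm : ∀ r : ℝ, δ < r → min 1 (δ / 2) ≤ min 1 (max 0 (r - δ / 2)) := fun r hr =>
      min_le_min le_rfl ((by linarith : δ / 2 ≤ r - δ / 2).trans (le_max_right _ _))
    have hGz : ∀ r : ℝ, r ≤ δ / 2 → min 1 (max 0 (r - δ / 2)) = 0 := fun r hr => by
      rw [max_eq_left (by linarith), min_eq_right (zero_le_one' ℝ)]
    have hA := hH (fun y => min 1 (max 0 (dev y - δ / 2))) (LipschitzWith.of_dist_le_mul fun a b => by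
        rw [NNReal.coe_one, one_mul, Real.dist_eq]
        calc |min 1 (max 0 (dev a - δ / 2)) - min 1 (max 0 (dev b - δ / 2))|
            ≤ |max 0 (dev a - δ / 2) - max 0 (dev b - δ / 2)| :=
              (abs_min_sub_min_le_max _ _ _ _).trans (by rw [sub_self, abs_zero, max_eq_right (abs_nonneg _)])
          _ ≤ |(dev a - δ / 2) - (dev b - δ / 2)| :=
              (abs_max_sub_max_le_max _ _ _ _).trans (by rw [sub_self, abs_zero, max_eq_right (abs_nonneg _)])
          _ = |dev a - dev b| := by rw [sub_sub_sub_cancel_right]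
          _ ≤ dist a b := hdev a b)
      (fun y => by rw [abs_of_nonneg (hG0 _)]; exact hG1 _)
    have hlow : ∀ N, min 1 (δ / 2) * (P N {x | δ < dev (gX N x)}).toReal ≤
        ∫ x, min 1 (max 0 (dev (gX N x) - δ / 2)) ∂P N := by
      intro N
      haveI := hP N
      have hE : MeasurableSet {x | δ < dev (gX N x)} := measurableSet_lt measurable_const (hmeas N)
      have hint : Integrable (fun x => min 1 (max 0 (dev (gX N x) - δ / 2))) (P N) := by
        refine Integrable.mono' (integrable_const (1 : ℝ)) ?_ (Eventually.of_forall fun x => ?_)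
        · exact ((continuous_const.min (continuous_const.max (continuous_id.sub continuous_const))).measurable.comp
            (hmeas N)).aestronglyMeasurable
        · rw [Real.norm_eq_abs, abs_of_nonneg (hG0 _)]; exact hG1 _
      have hind : ∫ x, {x | δ < dev (gX N x)}.indicator (fun _ => min 1 (δ / 2)) x ∂P N =
          min 1 (δ / 2) * (P N {x | δ < dev (gX N x)}).toReal := by
        rw [integral_indicator_const _ hE, smul_eq_mul, measureReal_def, mul_comm]
      rw [← hind]
      refine integral_mono ((integrable_const _).indicator hE) hint fun x => ?_
      by_cases hx : x ∈ {x | δ < dev (gX N x)}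
      · rw [Set.indicator_of_mem hx]; exact hGm _ hx
      · rw [Set.indicator_of_notMem hx]; exact hG0 _
    have hup : ∀ N, ∫ y, min 1 (max 0 (dev (gY N y) - δ / 2)) ∂μ N ≤ (μ N {y | δ / 2 < dev (gY N y)}).toReal := by
      intro N
      haveI := hμ N
      by_cases hint : Integrable (fun y => min 1 (max 0 (dev (gY N y) - δ / 2))) (μ N)
      · rw [integral_eq_lintegral_of_nonneg_ae (Eventually.of_forall fun y => hG0 _) hint.aestronglyMeasurable]
        refine ENNReal.toReal_mono (measure_ne_top _ _) ?_
        calc ∫⁻ y, ENNReal.ofReal (min 1 (max 0 (dev (gY N y) - δ / 2))) ∂μ N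
            ≤ ∫⁻ y, {y | δ / 2 < dev (gY N y)}.indicator (fun _ => (1 : ENNReal)) y ∂μ N :=
              lintegral_mono fun y => ?_
          _ ≤ ∫⁻ y in {y | δ / 2 < dev (gY N y)}, (fun _ => (1 : ENNReal)) y ∂μ N := lintegral_indicator_le _ _
          _ = μ N {y | δ / 2 < dev (gY N y)} := setLIntegral_one _
        by_cases hy : y ∈ {y | δ / 2 < dev (gY N y)}
        · rw [Set.indicator_of_mem hy]; exact ENNReal.ofReal_le_one.2 (hG1 _)
        · rw [Set.indicator_of_notMem hy]
          simp only [Set.mem_setOf_eq, not_lt] at hy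
          rw [hGz _ hy, ENNReal.ofReal_zero]
      · rw [integral_undef hint]; exact ENNReal.toReal_nonneg
    have hBr : Tendsto (fun N => (μ N {y | δ / 2 < dev (gY N y)}).toReal) atTop (𝓝 0) := by
      simpa [Function.comp_def] using (ENNReal.tendsto_toReal ENNReal.zero_ne_top).comp hB
    have hreal : Tendsto (fun N => (P N {x | δ < dev (gX N x)}).toReal) atTop (𝓝 0) := by
      refine squeeze_zero (fun N => ENNReal.toReal_nonneg) (fun N => ?_)
        (by simpa using (hA.abs.add hBr).div_const (min 1 (δ / 2)))
      rw [le_div_iff₀ hm0, mul_comm]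
      calc min 1 (δ / 2) * (P N {x | δ < dev (gX N x)}).toReal
          ≤ ∫ x, min 1 (max 0 (dev (gX N x) - δ / 2)) ∂P N := hlow N
        _ = ((∫ x, min 1 (max 0 (dev (gX N x) - δ / 2)) ∂P N) - ∫ y, min 1 (max 0 (dev (gY N y) - δ / 2)) ∂μ N) +
              ∫ y, min 1 (max 0 (dev (gY N y) - δ / 2)) ∂μ N := by ring
        _ ≤ _ := add_le_add (le_abs_self _) (hup N)
    have hne : ∀ N, P N {x | δ < dev (gX N x)} ≠ ⊤ := fun N => by haveI := hP N; exact measure_ne_top _ _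
    exact (ENNReal.tendsto_toReal_iff hne ENNReal.zero_ne_top).1 (by simpa using hreal)
  have hdD : ∀ (c : ℝ) (a b : ℝ × EuclideanSpace ℝ (Fin 3) × ℝ), |(|a.1 - c|) - (|b.1 - c|)| ≤ dist a b :=
    fun c a b => calc |(|a.1 - c|) - (|b.1 - c|)| ≤ |(a.1 - c) - (b.1 - c)| := abs_abs_sub_abs_le_abs_sub _ _
      _ = dist a.1 b.1 := by rw [sub_sub_sub_cancel_right, Real.dist_eq]
      _ ≤ dist a b := (le_max_left _ _).trans_eq Prod.dist_eq.symm
  have hdM : ∀ (c : EuclideanSpace ℝ (Fin 3)) (a b : ℝ × EuclideanSpace ℝ (Fin 3) × ℝ),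
      |‖a.2.1 - c‖ - ‖b.2.1 - c‖| ≤ dist a b :=
    fun c a b => calc |‖a.2.1 - c‖ - ‖b.2.1 - c‖| ≤ ‖(a.2.1 - c) - (b.2.1 - c)‖ := abs_norm_sub_norm_le _ _
      _ = dist a.2.1 b.2.1 := by rw [sub_sub_sub_cancel_right, dist_eq_norm]
      _ ≤ dist a.2 b.2 := (le_max_left _ _).trans_eq Prod.dist_eq.symm
      _ ≤ dist a b := (le_max_right _ _).trans_eq Prod.dist_eq.symm
  have hdE : ∀ (c : ℝ) (a b : ℝ × EuclideanSpace ℝ (Fin 3) × ℝ), |(|a.2.2 - c|) - (|b.2.2 - c|)| ≤ dist a b :=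
    fun c a b => calc |(|a.2.2 - c|) - (|b.2.2 - c|)| ≤ |(a.2.2 - c) - (b.2.2 - c)| := abs_abs_sub_abs_le_abs_sub _ _
      _ = dist a.2.2 b.2.2 := by rw [sub_sub_sub_cancel_right, Real.dist_eq]
      _ ≤ dist a.2 b.2 := (le_max_right _ _).trans_eq Prod.dist_eq.symm
      _ ≤ dist a b := (le_max_right _ _).trans_eq Prod.dist_eq.symm
  have hpos : ∀ (n : ℕ) (i : Fin n), Measurable fun z : Literature.Analysis.FluidPDE.Config n (Fin 3) (UnitAddTorus (Fin 3)) => (z i).1 :=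
    fun n i => (measurable_pi_apply i).fst
  have hvel : ∀ (n : ℕ) (i : Fin n), Measurable fun z : Literature.Analysis.FluidPDE.Config n (Fin 3) (UnitAddTorus (Fin 3)) => (z i).2 :=
    fun n i => (measurable_pi_apply i).snd
  have hmD : ∀ (n : ℕ) (χ : UnitAddTorus (Fin 3) → ℝ), Continuous χ →
      Measurable fun z : Literature.Analysis.FluidPDE.Config n (Fin 3) (UnitAddTorus (Fin 3)) => Literature.MathematicalPhysics.KineticTheory.empiricalDensityField z χ := by
    intro n χ hχ
    simp_rw [Literature.MathematicalPhysics.KineticTheory.empiricalDensityField_eq_sum]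
    exact measurable_const.mul (Finset.measurable_sum _ fun i _ => hχ.measurable.comp (hpos n i))
  have hmM : ∀ (n : ℕ) (χ : UnitAddTorus (Fin 3) → ℝ), Continuous χ →
      Measurable fun z : Literature.Analysis.FluidPDE.Config n (Fin 3) (UnitAddTorus (Fin 3)) => Literature.MathematicalPhysics.KineticTheory.empiricalMomentumField z χ := by
    intro n χ hχ
    simp_rw [Literature.MathematicalPhysics.KineticTheory.empiricalMomentumField_eq_sum]
    exact (Finset.measurable_sum _ fun i _ => (hχ.measurable.comp (hpos n i)).smul (hvel n i)).const_smul ((n : ℝ)⁻¹)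
  have hmE : ∀ (n : ℕ) (χ : UnitAddTorus (Fin 3) → ℝ), Continuous χ →
      Measurable fun z : Literature.Analysis.FluidPDE.Config n (Fin 3) (UnitAddTorus (Fin 3)) => Literature.MathematicalPhysics.KineticTheory.empiricalEnergyField z χ := by
    intro n χ hχ
    simp_rw [Literature.MathematicalPhysics.KineticTheory.empiricalEnergyField_eq_sum]
    exact measurable_const.mul (Finset.measurable_sum _ fun i _ =>
      (hχ.measurable.comp (hpos n i)).mul (((hvel n i).norm.pow_const 2).div_const 2))
  have hq_mem : ∀ N : ℕ, ((N : ℝ) + 1) ^ (-(1 / 6 : ℝ)) ∈ unitInterval := fun N =>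
    ⟨Real.rpow_nonneg (by positivity) _,
      Real.rpow_le_one_of_one_le_of_nonpos (by have := Nat.cast_nonneg (α := ℝ) N; linarith) (by norm_num)⟩
  let q : ℕ → unitInterval := fun N => ⟨((N : ℝ) + 1) ^ (-(1 / 6 : ℝ)), hq_mem N⟩
  have hN1 : Tendsto (fun N : ℕ => (N : ℝ) + 1) atTop atTop := tendsto_natCast_atTop_atTop.atTop_add tendsto_const_nhds
  have hq0 : Tendsto (fun N => (q N : ℝ)) atTop (𝓝 0) := (tendsto_rpow_neg_atTop (by norm_num : (0 : ℝ) < 1 / 6)).comp hN1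
  have hq1 : Tendsto (fun N : ℕ => (q N : ℝ) * ((N : ℝ) + 1) ^ (1 / 3 : ℝ)) atTop atTop := by
    refine ((tendsto_rpow_atTop (by norm_num : (0 : ℝ) < 1 / 6)).comp hN1).congr fun N => ?_
    show ((N : ℝ) + 1) ^ (1 / 6 : ℝ) = ((N : ℝ) + 1) ^ (-(1 / 6 : ℝ)) * ((N : ℝ) + 1) ^ (1 / 3 : ℝ)
    rw [← Real.rpow_add (by positivity : (0 : ℝ) < (N : ℝ) + 1)]
    norm_num
  intro a₀ θ₀ u₀ ha hθ hu ha0 hθ0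
  obtain ⟨σ₁, hσ₁, H₁⟩ := h₁ a₀ θ₀ u₀ ha hθ hu ha0 hθ0
  obtain ⟨σ₂, hσ₂, H₂⟩ := h₂ q hq0 hq1 a₀ θ₀ u₀ ha hθ hu ha0 hθ0
  refine ⟨min (min σ₁ σ₂) (1 / 2), by positivity, ?_⟩
  intro σ hσ hσlt T ρ θ u hsol Φ h0 t ht
  have hσ₁' : σ < σ₁ := lt_of_lt_of_le hσlt ((min_le_left _ _).trans (min_le_left _ _))
  have hσ₂' : σ < σ₂ := lt_of_lt_of_le hσlt ((min_le_left _ _).trans (min_le_right _ _))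
  have hPfin : ∀ N, IsFiniteMeasure (Literature.MathematicalPhysics.KineticTheory.localGibbsLaw σ a₀ u₀ θ₀ N (Φ N)) := fun N => by
    haveI := Literature.MathematicalPhysics.KineticTheory.isProbabilityMeasure_localGibbsLaw ha hθ hu ha0 hθ0 (lt_of_lt_of_le hσlt (min_le_right _ _)).le N (Φ N)
    infer_instance
  specialize H₁ σ hσ hσ₁' T ρ θ u hsol Φ h0 t ht
  specialize H₂ σ hσ hσ₂' T ρ θ u hsol Φ h0 t ht
  intro χ hχ δ hδ
  refine ⟨?_, ?_, ?_⟩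
  · have hres := key _ _ _ _ (fun F hF hF1 => H₁ χ hχ F hF hF1 q hq0) (fun y => |y.1 - ∫ x, χ x * ρ t x|) hδ (hdD _)
      hPfin (fun N => by dsimp only; infer_instance)
      (fun N => by exact continuous_abs.measurable.comp (((hmD (N + 1) χ hχ).comp ((Φ N).measurable_flow t)).sub measurable_const))
      (H₂ χ hχ (δ / 2) (half_pos hδ)).1
    exact hres
  · have hres := key _ _ _ _ (fun F hF hF1 => H₁ χ hχ F hF hF1 q hq0) (fun y => ‖y.2.1 - ∫ x, (χ x * ρ t x) • u t x‖) hδ (hdM _)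
      hPfin (fun N => by dsimp only; infer_instance)
      (fun N => by exact (((hmM (N + 1) χ hχ).comp ((Φ N).measurable_flow t)).sub measurable_const).norm)
      (H₂ χ hχ (δ / 2) (half_pos hδ)).2.1
    exact hres
  · have hres := key _ _ _ _ (fun F hF hF1 => H₁ χ hχ F hF hF1 q hq0)
      (fun y => |y.2.2 - ∫ x, χ x * Literature.MathematicalPhysics.KineticTheory.totalEnergyDensity (ρ t x) (u t x) (θ t x)|) hδ (hdE _)
      hPfin (fun N => by dsimp only; infer_instance)
      (fun N => by exact continuous_abs.measurable.comp (((hmE (N + 1) χ hχ).comp ((Φ N).measurable_flow t)).sub measurable_const))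
      (H₂ χ hχ (δ / 2) (half_pos hδ)).2.2
    exact hres

end Summit.AtomisticToContinuum.HydrodynamicLimit.Theses.VanishingNoise
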